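import Literature.Probability.RandomPlanarGeometry.CritPercSLESwallowing
import Literature.Probability.RandomPlanarGeometry.SLESwallowedRealPoints
import HarnessLib

/-!
# Rohde–Schramm's Lemma 6.6: the event `{X ≥ s}` is `{T_1 = T_s}`, and the trace obstruction

Topic `Probability/RandomPlanarGeometry`; theorems only. S. Rohde, O. Schramm, *Basic properties
of SLE*, Ann. of Math. 161 (2005), Lemma 6.6 (p. 908) computes, for `κ ∈ (4, 8)` and
`X = inf([1, ∞) ∩ γ[0, ∞))`, the law `P[X ≥ s]` (eq. (6.13)); the tree vendors it as the named
fact `Literature.Probability.RandomPlanarGeometry.sle_measureReal_Ico_disjoint_range_eq`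
(`CritPercSLESwallowing.lean`), with the event `{X ≥ s}` written "no real `y ∈ [1, s)` is on the
trace `sleTrace κ ω`". This file records two proved facts about that statement.

* **Event identification** (deterministic; the first sentence of the printed proof, "let
  `Y_t := (g_t(1) - ξ(t))/(g_t(s) - ξ(t))` … for `t < τ(1)`", uses that `{X ≥ s}` is decided by
  the real flows of `1` and `s`): for a chain generated by a curve `γ` with continuous driving
  function started at `0` and `0 < x ≤ s`, **no point of `[x, s)` is on `γ` iff `T_x = T_s`**
  (`Loewner.IsGeneratedByCurve.forall_notMem_range_iff_swallowingTime_eq`). Indeed swallowing of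
  real points is hitting of real rays (`Loewner.swallowingTime_ofReal_eq_firstHit_of_ne`, Lawler
  (2005), Rem. 6.6, proved in the tree): if `[x, s) ∩ γ = ∅` the rays `[x, ∞)` and `[s, ∞)` are
  hit at the same times; conversely if `T_x = T_s` then every `y ∈ [x, s)` has `T_y = T_s`
  (monotonicity, `Loewner.swallowingTime_mono_right`), so the first hit of `[y, ∞)` is the first
  hit of `[s, ∞)`, which is not at `y`, and a real point first hit strictly inside its ray is never
  visited (`Loewner.IsGeneratedByCurve.ofReal_notMem_range_of_apply_firstHit_ne`). Hence, on the
  path space, `{∀ y ∈ [1, s), y ∉ sleTrace} = {chain generated by a curve → T_1 = T_s}` **exactly**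
  (`setOf_forall_notMem_range_sleTrace_eq`; on the event where the chain is not generated by a
  curve the trace is the junk constant `0`, `Loewner.trace`), and `= {T_1 = T_s}` almost surely
  given `HasSLETrace κ` (`measureReal_forall_notMem_range_sleTrace_eq`).
* **The trace obstruction**: because of that junk branch, the vendored statement *implies the
  Rohde–Schramm trace theorem on `(4, 8)`*: `sle_measureReal_Ico_disjoint_range_eq → HasSLETrace κ`
  for every `κ ∈ (4, 8)` (`hasSLETrace_of_sle_measureReal_Ico_disjoint_range_eq`): the
  non-generated event lies in `{X ≥ s}` for every `s`, and the right-hand side of (6.13) tends to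
  `0` as `s → ∞` (`tendsto_rohdeSchramm613_atTop`: `₂F₁(…; 1/s) → ₂F₁(…; 0) = 1` by analyticity of
  Mathlib's `ordinaryHypergeometric` on its unit disc of convergence, and `s^{(4-κ)/κ} → 0`).
  Consequently (`sle_measureReal_Ico_disjoint_range_eq_iff`) the fact is **equivalent** to the
  conjunction of `HasSLETrace κ` on `(4, 8)` (the `κ ∈ (4, 8)` slice of the tree's named fact
  `hasSLETrace_of_ne_eight`, RS05 Thm 5.1, reduced in the tree to Cor. 3.5,
  `hasSLETrace_of_ne_eight_of_cor35`) and the two-point swallowing law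
  `P[T_1 = T_s] = (6.13)` for the real SLE_κ flow — the genuine content of Lemma 6.6, whose weak
  forms are proved in `SLESameSideSwallowing.lean` / `SLESwallowedRealPoints.lean`.

## References

* S. Rohde, O. Schramm, *Basic properties of SLE*, Ann. of Math. 161 (2005), Lemma 6.6, eq. (6.13)
  and its proof (p. 908); Thm 5.1.
* G. F. Lawler, *Conformally Invariant Processes in the Plane*, AMS (2005), Rem. 6.6, Prop. 6.34.
-/

noncomputable section

open Set Filter Topology MeasureTheory Complex
open scoped NNReal ENNReal Real

namespace Literature.Probability.RandomPlanarGeometry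

namespace Loewner

variable {W : ℝ≥0 → ℝ} {γ : ℝ≥0 → ℂ}

/-! ### Deterministic: `[x, s) ∩ γ = ∅` iff `T_x = T_s` -/

/-- If no real point of `[x, s)` (`0 < x ≤ s`) is on the path `γ`, then `γ` is on the ray
`[x, ∞)` exactly when it is on the ray `[s, ∞)`. [folklore] -/
theorem mem_realRay_iff_of_forall_notMem_range {x s : ℝ} (hx : 0 < x) (hxs : x ≤ s)
    (h : ∀ y : ℝ, x ≤ y → y < s → (y : ℂ) ∉ range γ) (t : ℝ≥0) :
    γ t ∈ realRay x ↔ γ t ∈ realRay s := by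
  refine ⟨fun ht ↦ ?_, fun ht ↦ realRay_subset_realRay_of_pos hx hxs ht⟩
  rw [mem_realRay_iff_of_pos hx] at ht
  rw [mem_realRay_iff_of_pos (hx.trans_le hxs)]
  refine ⟨ht.1, le_of_not_gt fun hlt ↦ h (γ t).re ht.2 hlt ⟨t, ?_⟩⟩
  exact Complex.ext (by simp) (by simp [ht.1])

/-- **No point of `[x, s)` on the curve forces `T_x = T_s`** (`0 < x ≤ s`; chain generated by `γ`,
continuous driving function started at `0`): both swallowing times are first hitting times of the
rays `[x, ∞) ⊇ [s, ∞)` (`swallowingTime_ofReal_eq_firstHit_of_ne`), hit at the same times.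
[cite: RohdeSchramm2005, Lemma 6.6 (proof)] -/
theorem IsGeneratedByCurve.swallowingTime_eq_of_forall_notMem_range (hγ : IsGeneratedByCurve W γ)
    (hW : Continuous W) (hW0 : W 0 = 0) {x s : ℝ} (hx : 0 < x) (hxs : x ≤ s)
    (h : ∀ y : ℝ, x ≤ y → y < s → (y : ℂ) ∉ range γ) :
    swallowingTime W x = swallowingTime W s := by
  rw [swallowingTime_ofReal_eq_firstHit_of_ne hW hW0 hγ hx.ne',
    swallowingTime_ofReal_eq_firstHit_of_ne hW hW0 hγ (hx.trans_le hxs).ne']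
  exact firstHit_congr (mem_realRay_iff_of_forall_notMem_range hx hxs h)

/-- **`T_x = T_s` forces `[x, s) ∩ γ = ∅`** (`0 < x ≤ s`; chain generated by `γ`, continuous
driving function started at `0`): for `y ∈ [x, s)`, `T_x ≤ T_y ≤ T_s` (`swallowingTime_mono_right`)
gives `T_y = T_s`, so the first hit of `[y, ∞)` is the first hit of `[s, ∞)`, at a point of real
part `≥ s > y`; a real point first hit strictly inside its ray is never visited
(`IsGeneratedByCurve.ofReal_notMem_range_of_apply_firstHit_ne`).
[cite: RohdeSchramm2005, Lemma 6.6 (proof)] -/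
theorem IsGeneratedByCurve.forall_notMem_range_of_swallowingTime_eq (hγ : IsGeneratedByCurve W γ)
    (hW : Continuous W) (hW0 : W 0 = 0) {x s : ℝ} (hx : 0 < x)
    (h : swallowingTime W x = swallowingTime W s) :
    ∀ y : ℝ, x ≤ y → y < s → (y : ℂ) ∉ range γ := by
  intro y hxy hys
  have hy : 0 < y := hx.trans_le hxy
  have hW0x : W 0 < x := by rwa [hW0]
  have hW0y : W 0 < y := by rwa [hW0]
  -- `T_y = T_s`
  have hTy : swallowingTime W y = swallowingTime W s := by
    refine le_antisymm (swallowingTime_mono_right hW hW0y hys.le) ?_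
    rw [← h]
    exact swallowingTime_mono_right hW hW0x hxy
  refine hγ.ofReal_notMem_range_of_apply_firstHit_ne hW hW0 hy.ne' fun t₀ ht₀ ↦ ?_
  -- the first hit of `realRay s` is also at `t₀`, so `re γ t₀ ≥ s > y`
  have hs0 : s ≠ 0 := (hy.trans hys).ne'
  have hTs : firstHit γ (realRay s) = t₀ := by
    rw [← swallowingTime_ofReal_eq_firstHit_of_ne hW hW0 hγ hs0, ← hTy,
      swallowingTime_ofReal_eq_firstHit_of_ne hW hW0 hγ hy.ne', ht₀]
  obtain ⟨t₁, ht₁, hmem⟩ := exists_firstHit_eq_coe hγ.continuous (isClosed_realRay s)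
    (by rw [hTs]; exact WithTop.coe_ne_top)
  rw [hTs] at ht₁
  have h01 : t₀ = t₁ := WithTop.coe_injective ht₁
  subst h01
  intro heq
  rw [heq, mem_realRay_iff_of_pos (hy.trans hys), ofReal_re] at hmem
  linarith [hmem.2]

/-- **`[x, s) ∩ γ = ∅ ↔ T_x = T_s`** for `0 < x ≤ s` and a chain generated by the curve `γ` with
continuous driving function started at `0`: the event `{X ≥ s}`, `X = inf([1, ∞) ∩ γ[0, ∞))`, of
Rohde–Schramm's Lemma 6.6 is the event `{τ(1) = τ(s)}` of its proof.
[cite: RohdeSchramm2005, Lemma 6.6 (proof)] -/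
theorem IsGeneratedByCurve.forall_notMem_range_iff_swallowingTime_eq (hγ : IsGeneratedByCurve W γ)
    (hW : Continuous W) (hW0 : W 0 = 0) {x s : ℝ} (hx : 0 < x) (hxs : x ≤ s) :
    (∀ y : ℝ, x ≤ y → y < s → (y : ℂ) ∉ range γ) ↔ swallowingTime W x = swallowingTime W s :=
  ⟨hγ.swallowingTime_eq_of_forall_notMem_range hW hW0 hx hxs,
    hγ.forall_notMem_range_of_swallowingTime_eq hW hW0 hx⟩

/-- The junk branch of `Loewner.trace`: if the chain is not generated by a curve, the trace is the
constant curve `W 0`. [folklore] -/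
theorem trace_of_not_exists (h : ¬ ∃ γ, IsGeneratedByCurve W γ) :
    trace W = fun _ ↦ ((W 0 : ℝ) : ℂ) := by
  rw [trace, dif_neg h]

end Loewner

/-! ### The event of Lemma 6.6 on the SLE path space -/

variable {κ : ℝ≥0}

/-- **The event `{X ≥ s}` of Lemma 6.6 on the path space, exactly**: for `s ≥ 1`, the set of paths
for which no real `y ∈ [1, s)` is on `sleTrace κ ω` is the set of paths for which *if* the SLE_κ
chain is generated by a curve *then* `T_1 = T_s` (on the non-generated event the trace is the junk
constant `0 ∉ [1, s)`). [cite: RohdeSchramm2005, Lemma 6.6 (proof)] -/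
theorem setOf_forall_notMem_range_sleTrace_eq {s : ℝ} (hs : 1 ≤ s) :
    {ω | ∀ y : ℝ, 1 ≤ y → y < s → (y : ℂ) ∉ range (sleTrace κ ω)} =
      {ω | (∃ γ, Loewner.IsGeneratedByCurve (sleDriving κ ω) γ) →
        Loewner.swallowingTime (sleDriving κ ω) 1 = Loewner.swallowingTime (sleDriving κ ω) s} := by
  ext ω
  simp only [mem_setOf_eq]
  by_cases hG : ∃ γ, Loewner.IsGeneratedByCurve (sleDriving κ ω) γ
  · have hiff := (Loewner.isGeneratedByCurve_trace hG).forall_notMem_range_iff_swallowingTime_eq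
      (continuous_sleDriving κ ω) (sleDriving_zero κ ω) one_pos hs
    change (∀ y : ℝ, 1 ≤ y → y < s → (y : ℂ) ∉ range (Loewner.trace (sleDriving κ ω))) ↔ _
    rw [hiff]
    exact ⟨fun h _ ↦ h, fun h ↦ h hG⟩
  · have htr : sleTrace κ ω = fun _ ↦ ((sleDriving κ ω 0 : ℝ) : ℂ) :=
      Loewner.trace_of_not_exists hG
    rw [sleDriving_zero] at htr
    refine ⟨fun _ h ↦ absurd h hG, fun _ y hy _ hmem ↦ ?_⟩
    rw [htr] at hmem
    obtain ⟨t, ht⟩ := hmem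
    have ht' : ((0 : ℝ) : ℂ) = (y : ℂ) := ht
    have hy0 : (0 : ℝ) = y := by exact_mod_cast ht'
    linarith

/-- **Given the trace, `{X ≥ s}` is `{T_1 = T_s}` almost surely**: if SLE_κ is generated by a curve
(`HasSLETrace κ`), then for `s ≥ 1`,
`P[∀ y ∈ [1, s), y ∉ γ] = P[T_1 = T_s]`. [cite: RohdeSchramm2005, Lemma 6.6 (proof)] -/
theorem measureReal_forall_notMem_range_sleTrace_eq (hT : HasSLETrace κ) {s : ℝ} (hs : 1 ≤ s) :
    Process.preWienerMeasure.real {ω | ∀ y : ℝ, 1 ≤ y → y < s → (y : ℂ) ∉ range (sleTrace κ ω)} =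
      Process.preWienerMeasure.real
        {ω | Loewner.swallowingTime (sleDriving κ ω) 1 = Loewner.swallowingTime (sleDriving κ ω) s} := by
  rw [setOf_forall_notMem_range_sleTrace_eq hs]
  refine measureReal_congr ?_
  filter_upwards [hT] with ω hG
  simp only [eq_iff_iff]
  exact ⟨fun h ↦ h hG, fun h _ ↦ h⟩

/-! ### The right-hand side of (6.13) at `s = ∞`, and the trace obstruction -/

/-- **The right-hand side of (6.13) tends to `0` as `s → ∞`** (`4 < κ < 8`; "zero when
`s = ∞`", p. 908): `₂F₁(1 - 4/κ, 2 - 8/κ; 2 - 4/κ; 1/s) → ₂F₁(…; 0) = 1` (Mathlib's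
`ordinaryHypergeometric` is analytic, hence continuous, on the unit disc, its disc of convergence
since no parameter is a non-positive integer), while `s^{(4-κ)/κ} → 0`.
[cite: RohdeSchramm2005, Lemma 6.6 (proof)] -/
theorem tendsto_rohdeSchramm613_atTop (hκ : 4 < κ) :
    Tendsto (fun s : ℝ ↦ (4 : ℝ) ^ (((κ : ℝ) - 4) / κ) * Real.sqrt π *
          ₂F₁ (1 - 4 / (κ : ℝ)) (2 - 8 / (κ : ℝ)) (2 - 4 / (κ : ℝ)) (1 / s) *
          s ^ ((4 - (κ : ℝ)) / κ) /
        (Real.Gamma (2 - 4 / (κ : ℝ)) * Real.Gamma (4 / (κ : ℝ) - 1 / 2))) atTop (𝓝 0) := by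
  have hκ0 : (0 : ℝ) < κ := by exact_mod_cast (zero_lt_four.trans hκ)
  have hκ4 : (4 : ℝ) < κ := by exact_mod_cast hκ
  have h4κ : 4 / (κ : ℝ) < 1 := (div_lt_one hκ0).2 hκ4
  have h8κ : 8 / (κ : ℝ) < 2 := by
    rw [div_lt_iff₀ hκ0]; linarith
  -- `₂F₁(…; 1/s) → 1`
  have hF : Tendsto (fun s : ℝ ↦ ₂F₁ (1 - 4 / (κ : ℝ)) (2 - 8 / (κ : ℝ)) (2 - 4 / (κ : ℝ)) (1 / s))
      atTop (𝓝 1) := by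
    set p : FormalMultilinearSeries ℝ ℝ ℝ :=
      ordinaryHypergeometricSeries ℝ (1 - 4 / (κ : ℝ)) (2 - 8 / (κ : ℝ)) (2 - 4 / (κ : ℝ)) with hp
    have hrad : p.radius = 1 := by
      refine ordinaryHypergeometricSeries_radius_eq_one _ _ _ _ fun kn ↦ ⟨?_, ?_, ?_⟩
      · have : (0 : ℝ) ≤ kn := kn.cast_nonneg
        intro h; linarith
      · have : (0 : ℝ) ≤ kn := kn.cast_nonneg
        intro h; linarith
      · have : (0 : ℝ) ≤ kn := kn.cast_nonneg
        intro h; linarith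
    have hps : HasFPowerSeriesOnBall p.sum p 0 p.radius :=
      p.hasFPowerSeriesOnBall (by rw [hrad]; exact one_pos)
    have hcont : ContinuousAt
        (₂F₁ (1 - 4 / (κ : ℝ)) (2 - 8 / (κ : ℝ)) (2 - 4 / (κ : ℝ)) : ℝ → ℝ) 0 :=
      hps.hasFPowerSeriesAt.continuousAt
    have h0 : Tendsto (fun s : ℝ ↦ 1 / s) atTop (𝓝 0) := by
      simpa only [one_div] using tendsto_inv_atTop_zero
    have := hcont.tendsto.comp h0
    rwa [ordinaryHypergeometric_zero] at this
  -- `s^{(4-κ)/κ} → 0`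
  have hpow : Tendsto (fun s : ℝ ↦ s ^ ((4 - (κ : ℝ)) / κ)) atTop (𝓝 0) := by
    have hneg : (4 - (κ : ℝ)) / κ = -(((κ : ℝ) - 4) / κ) := by ring
    rw [hneg]
    exact tendsto_rpow_neg_atTop (div_pos (by linarith) hκ0)
  have := ((hF.const_mul ((4 : ℝ) ^ (((κ : ℝ) - 4) / κ) * Real.sqrt π)).mul hpow).div_const
    (Real.Gamma (2 - 4 / (κ : ℝ)) * Real.Gamma (4 / (κ : ℝ) - 1 / 2))
  rw [mul_one, mul_zero, zero_div] at this
  exact this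

/-- **The vendored Lemma 6.6 implies the trace theorem on `(4, 8)`.** Because `sleTrace κ ω` is the
junk constant curve `0` when the SLE_κ chain of `ω` is not generated by a curve, that event lies in
`{∀ y ∈ [1, s), y ∉ sleTrace}` for every `s ≥ 1`; under `sle_measureReal_Ico_disjoint_range_eq`
its probability is at most the right-hand side of (6.13), which tends to `0` as `s → ∞`
(`tendsto_rohdeSchramm613_atTop`). So the fact yields `HasSLETrace κ` for all `κ ∈ (4, 8)`, the
`(4, 8)` slice of Rohde–Schramm's Thm 5.1 (`hasSLETrace_of_ne_eight`, reduced in the tree to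
Cor. 3.5 by `hasSLETrace_of_ne_eight_of_cor35`): a discharge of the fact must prove that slice.
[cite: RohdeSchramm2005, Lemma 6.6 and Thm 5.1] -/
theorem hasSLETrace_of_sle_measureReal_Ico_disjoint_range_eq
    (h : sle_measureReal_Ico_disjoint_range_eq) (hκ : 4 < κ) (hκ' : κ < 8) : HasSLETrace κ := by
  haveI := isProbabilityMeasure_preWienerMeasure'
  set N : Set (ℝ≥0 → ℝ) := {ω | ¬ ∃ γ, Loewner.IsGeneratedByCurve (sleDriving κ ω) γ} with hN
  have hsub : ∀ s : ℝ, 1 ≤ s →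
      N ⊆ {ω | ∀ y : ℝ, 1 ≤ y → y < s → (y : ℂ) ∉ range (sleTrace κ ω)} := by
    intro s hs ω hω
    rw [setOf_forall_notMem_range_sleTrace_eq hs]
    exact fun hG ↦ absurd hG hω
  have hle : ∀ s : ℝ, 1 ≤ s → Process.preWienerMeasure.real N ≤
      (4 : ℝ) ^ (((κ : ℝ) - 4) / κ) * Real.sqrt π *
          ₂F₁ (1 - 4 / (κ : ℝ)) (2 - 8 / (κ : ℝ)) (2 - 4 / (κ : ℝ)) (1 / s) *
          s ^ ((4 - (κ : ℝ)) / κ) /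
        (Real.Gamma (2 - 4 / (κ : ℝ)) * Real.Gamma (4 / (κ : ℝ) - 1 / 2)) := fun s hs ↦ by
    rw [← h hκ hκ' hs]
    exact measureReal_mono (hsub s hs)
  have h0 : Process.preWienerMeasure.real N ≤ 0 :=
    ge_of_tendsto (tendsto_rohdeSchramm613_atTop hκ)
      (by filter_upwards [eventually_ge_atTop (1 : ℝ)] with s hs using hle s hs)
  have hN0 : Process.preWienerMeasure N = 0 := by
    rw [← measureReal_eq_zero_iff]
    exact le_antisymm h0 measureReal_nonneg
  rw [HasSLETrace, ae_iff]
  exact hN0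

/-- **What the vendored Lemma 6.6 amounts to.** `sle_measureReal_Ico_disjoint_range_eq` holds iff,
for every `κ ∈ (4, 8)`, SLE_κ is generated by a curve (`HasSLETrace κ`, RS05 Thm 5.1) **and** the
two real points `1 < s` are swallowed simultaneously with probability given by (6.13):
`P[T_1 = T_s] = 4^{(κ-4)/κ} √π ₂F₁(1 - 4/κ, 2 - 8/κ; 2 - 4/κ; 1/s) s^{(4-κ)/κ} / (Γ(2-4/κ) Γ(4/κ-1/2))`
for all `s ≥ 1` — the two-point law for the real SLE_κ flow that the printed proof establishes
("`F(1/Y_t)` is a local martingale … optional sampling", p. 908).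
[cite: RohdeSchramm2005, Lemma 6.6] -/
theorem sle_measureReal_Ico_disjoint_range_eq_iff :
    sle_measureReal_Ico_disjoint_range_eq ↔
      ∀ ⦃κ : ℝ≥0⦄, 4 < κ → κ < 8 → HasSLETrace κ ∧ ∀ ⦃s : ℝ⦄, 1 ≤ s →
        Process.preWienerMeasure.real
            {ω | Loewner.swallowingTime (sleDriving κ ω) 1 =
              Loewner.swallowingTime (sleDriving κ ω) s} =
          (4 : ℝ) ^ (((κ : ℝ) - 4) / κ) * Real.sqrt π *
              ₂F₁ (1 - 4 / (κ : ℝ)) (2 - 8 / (κ : ℝ)) (2 - 4 / (κ : ℝ)) (1 / s) *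
              s ^ ((4 - (κ : ℝ)) / κ) /
            (Real.Gamma (2 - 4 / (κ : ℝ)) * Real.Gamma (4 / (κ : ℝ) - 1 / 2)) := by
  constructor
  · intro h κ hκ hκ'
    have hT : HasSLETrace κ := hasSLETrace_of_sle_measureReal_Ico_disjoint_range_eq h hκ hκ'
    refine ⟨hT, fun s hs ↦ ?_⟩
    rw [← measureReal_forall_notMem_range_sleTrace_eq hT hs]
    exact h hκ hκ' hs
  · intro h κ hκ hκ' s hs
    obtain ⟨hT, hlaw⟩ := h hκ hκ'
    rw [measureReal_forall_notMem_range_sleTrace_eq hT hs]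
    exact hlaw hs

end Literature.Probability.RandomPlanarGeometry
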